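import Mathlib.Tactic
import HarnessLib

/-!
# Kozma–Nitzan's Question 8 at three relays — two scalar cores of the κ = 2 one-block analysis (gen 20):
# the deletion–contraction step of LEMMA W (`m ≥ π ε` for every rooted graph) and the monotonicity of the attachment probability

Support file (`--supports stmt-CriticalPhenomena-4575`, closed crux; independent mathematics on Kozma–Nitzan's Question 8,
arXiv:2401.12397 §5.5 p. 36), prover `prim-ineq-gen-6` (gen 20).  No definitions, no named facts, no sorries; standard axioms.
Memo `run/shared/lean/prim/prim-ineq-gen-6/FINDING-G20.md` §2 (LEMMA W ⇒ the marker bit eliminates exactly at the corner C2) and §4 (the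
EMBEDDING ORDER: the attachment probability `r_J = 1 − A_J C_J/(A_J + C_J − A_J C_J)` of a non-mixed fragment is monotone in the fragment, because
`A_J`, `C_J` are products of numbers in `(0,1]` and `(A,C) ↦ A C/(A + C − A C)` is monotone in each argument).
* `lemmaW_mix` — if `m_i ≥ π_i ε_i` (`i = 0,1`), `π₀ ≥ π₁`, `ε₀ ≥ ε₁` and `x = s x₁ + (1−s) x₀` for `x ∈ {π, ε, m}`, `s ∈ [0,1]`, then `m ≥ π ε`
  (identity `m − πε = s(m₁−π₁ε₁) + (1−s)(m₀−π₀ε₀) + s(1−s)(π₀−π₁)(ε₀−ε₁)`); `lemmaW_base` — the edgeless root: `m = a c φ`, `π = c φ`, `ε = a φ`, `φ ≤ 1`.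
* `attachWeight_mono` — `A' C'/(A' + C' − A' C') ≤ A C/(A + C − A C)` for `0 < A' ≤ A`, `0 < C' ≤ C ≤ 1`; hence `r` is monotone (`attachProb_mono`).
[cite: KozmaNitzan2024, Question 8 (§5.5 p. 36)]
-/

namespace Summit.CriticalPhenomena.PercolationContinuityZ3.Theorems

namespace PocketCert

/-- **LEMMA W, deletion–contraction step.**  The non-affine quantity `m − π ε` of a rooted block mixes along a root edge of weight `s` as
`s(m₁−π₁ε₁) + (1−s)(m₀−π₀ε₀) + s(1−s)(π₀−π₁)(ε₀−ε₁)`; with the inductive hypotheses and the monotonicities `π₀ ≥ π₁`, `ε₀ ≥ ε₁`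
(deletion ≥ contraction) it stays nonnegative.  [cite: KozmaNitzan2024, Question 8 (§5.5 p. 36)] -/
theorem lemmaW_mix (s π₀ π₁ ε₀ ε₁ m₀ m₁ : ℝ) (hs0 : 0 ≤ s) (hs1 : s ≤ 1)
    (h0 : π₀ * ε₀ ≤ m₀) (h1 : π₁ * ε₁ ≤ m₁) (hπ : π₁ ≤ π₀) (hε : ε₁ ≤ ε₀) :
    (s * π₁ + (1 - s) * π₀) * (s * ε₁ + (1 - s) * ε₀) ≤ s * m₁ + (1 - s) * m₀ := by
  have key : s * m₁ + (1 - s) * m₀ - (s * π₁ + (1 - s) * π₀) * (s * ε₁ + (1 - s) * ε₀)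
      = s * (m₁ - π₁ * ε₁) + (1 - s) * (m₀ - π₀ * ε₀) + s * (1 - s) * ((π₀ - π₁) * (ε₀ - ε₁)) := by ring
  have h2 : 0 ≤ (π₀ - π₁) * (ε₀ - ε₁) := mul_nonneg (by linarith) (by linarith)
  nlinarith [mul_nonneg hs0 (sub_nonneg.2 hs1), mul_nonneg hs0 (sub_nonneg.2 h1),
    mul_nonneg (sub_nonneg.2 hs1) (sub_nonneg.2 h0), mul_nonneg (mul_nonneg hs0 (sub_nonneg.2 hs1)) h2]

/-- **LEMMA W, base.**  A root with no root edge: `m = a c φ`, `π = c φ`, `ε = a φ` with `a, c ≥ 0`, `0 ≤ φ ≤ 1` give `π ε ≤ m`.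
[cite: KozmaNitzan2024, Question 8 (§5.5 p. 36)] -/
theorem lemmaW_base (a c φ : ℝ) (ha : 0 ≤ a) (hc : 0 ≤ c) (hφ0 : 0 ≤ φ) (hφ1 : φ ≤ 1) :
    (c * φ) * (a * φ) ≤ a * c * φ := by
  have : (c * φ) * (a * φ) = (a * c * φ) * φ := by ring
  rw [this]
  have hacφ : 0 ≤ a * c * φ := mul_nonneg (mul_nonneg ha hc) hφ0
  nlinarith

/-- **Monotonicity of the attachment weight.**  `(A,C) ↦ A C/(A + C − A C)` is monotone in each argument on `(0,1]²`
(it equals `1/(1/A + 1/C − 1)`).  [cite: KozmaNitzan2024, Question 8 (§5.5 p. 36)] -/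
theorem attachWeight_mono (A A' C C' : ℝ) (hA' : 0 < A') (hAA : A' ≤ A)
    (hC' : 0 < C') (hCC : C' ≤ C) (hC1 : C ≤ 1) :
    A' * C' / (A' + C' - A' * C') ≤ A * C / (A + C - A * C) := by
  have hA : 0 < A := lt_of_lt_of_le hA' hAA
  have hC : 0 < C := lt_of_lt_of_le hC' hCC
  have hM' : 0 < A' + C' - A' * C' := by nlinarith [mul_nonneg hA'.le (sub_nonneg.2 (le_trans hCC hC1))]
  have hM : 0 < A + C - A * C := by nlinarith [mul_nonneg hA.le (sub_nonneg.2 hC1)]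
  rw [div_le_div_iff₀ hM' hM]
  -- A'C'(A + C − AC) ≤ AC(A' + C' − A'C')  ⟺  A'C'A + A'C'C ≤ ACA' + ACC' ⟺ A'C'A(1) ... ⟺ A A'(C − C') ... expand:
  -- AC A' + AC C' − A'C' A − A'C' C = A A'(C − C') + C C'(A − A') ≥ 0
  nlinarith [mul_nonneg (mul_nonneg hA.le hA'.le) (sub_nonneg.2 hCC), mul_nonneg (mul_nonneg hC.le hC'.le) (sub_nonneg.2 hAA)]

/-- **The attachment probability is monotone in the fragment.**  With `r(A,C) = 1 − A C/(A + C − A C)`: enlarging the fragment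
(`A ↦ A' ≤ A`, `C ↦ C' ≤ C`) does not decrease `r`.  This is the Lemma behind the EMBEDDING ORDER of FINDING-G20 §4.
[cite: KozmaNitzan2024, Question 8 (§5.5 p. 36)] -/
theorem attachProb_mono (A A' C C' : ℝ) (hA' : 0 < A') (hAA : A' ≤ A)
    (hC' : 0 < C') (hCC : C' ≤ C) (hC1 : C ≤ 1) :
    1 - A * C / (A + C - A * C) ≤ 1 - A' * C' / (A' + C' - A' * C') := by
  have := attachWeight_mono A A' C C' hA' hAA hC' hCC hC1
  linarith

end PocketCert

end Summit.CriticalPhenomena.PercolationContinuityZ3.Theorems
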